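import Literature.NumberTheory.EllipticCurves.ThreeIsogenySelmerRatioTwistFamilies
import Literature.NumberTheory.EllipticCurves.QuadraticTwistRationalTorsionFiniteProofs
import HarnessLib

/-!
# The `φ`-Selmer group of an isogeny; Bhargava–Klagsbrun–Lemke Oliver–Shnidman 2019, Thm. 2.1
# and its §9 inputs (Cassels' formula; parity of the `3`-Selmer rank on `T_m(φ)`)

Cross-ladder literature-typing layer (cell `bsd-littype`, seat 08, gen 6; "typed ≠ proved ≠
endorsed"). This file supplies the ONE carrier that `ThreeIsogenySelmerRatioTwistFamilies.lean`
(gen 5) recorded as missing (`OPEN-QUESTIONS-08.md` §H, row BKLOS-Q2) — the `φ`-Selmer group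
`Sel_φ(E/K) ⊆ H¹(K, E[φ])` of an isogeny `φ : E → E'` over a number field — and then types the MAIN
theorem of Bhargava–Klagsbrun–Lemke Oliver–Shnidman, Duke Math. J. **168** (2019) = arXiv:1709.09790
(REFEREED), Thm. 2.1 (average size of `Sel_{φ_s}(E_s)` in the quadratic twist family of a
`3`-isogeny), with the two printed inputs of its §9: Cassels' formula for the Selmer ratio (§9.1
display (9.2), [Cassels 1965, VIII]) and the parity statement of §9.2 in the precise form of
Bhargava–Elkies–Shnidman, J. Lond. Math. Soc. **101** (2020), Prop. 42 (ii). Held texts: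
`paper:arxiv-1709.09790` (LaTeXML chunks `pNNNN`, `L` = line; Duke numbering, cf. Burungale–Tian,
Ann. of Math. 203 (2026) p. 7 "[1, Thm. 2.7]") and `paper:arxiv-1610.05759` (BES, chunks).

## The carrier (definitions with bodies)

BKLOS §7 (p0011 L3–L9): "the `φ`-Selmer group `Sel_φ(A)` is the subgroup of `H¹(G_F, A[φ])` of
classes that are locally in the image of the Kummer map `∂_v : A'(F_v) → H¹(G_{F_v}, A[φ])` for every
place `v` of `F`. Equivalently, these are the classes locally in the kernel of the map
`H¹(G_{F_v}, A[φ]) → H¹(G_{F_v}, A)` for every place `v`". We take the second (kernel) form, exactly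
as the tree's `WeierstrassCurve.selmerGroup n = ker (H¹(K, E[n]) → ∏_v H¹(K_v, E))` (`Selmer.lean`):
`Isogeny.kerAction` (the `Γ_K`-module `E[φ] = ker φ`, an `abbrev` and NOT an instance — fed to the
tree's glue `discreteH1` / `resKer` by `letI`), `Isogeny.galH1Ker = H¹(K, E[φ])` (Mathlib's
`continuousCohomology 1`), `Isogeny.selmerLocalKer` (local kernel along the compatible pair
`(resGal E, pointsMap ∘ (E[φ] ↪ E(K̄)))`), `Isogeny.selmerGroup = Sel_φ(E/K)` with
`mem_selmerGroup_iff`, and `Isogeny.ratKerCard = #E[φ](K)` (`Γ_K`-fixed points of the kernel).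

## Typed statements (named facts, REFEREED) and what is proved

| source | declaration | grade |
|---|---|---|
| BKLOS Thm. 2.1, p0004 L32–L36 (+ Thm. 8.1, p0012 L41–L48) | `BhargavaKlagsbrunLemkeOliverShnidman2019.thm21_averageCard_selmerGroup` | FAITHFUL for elliptic curves (printed for abelian varieties — `TODO(general form)`); `avg_Σ c(φ_s)`, the source's LIMIT (p0004 L26–L30), enters as the hypothesis `Tendsto … (𝓝 a)`, as in `thm24_averageRank_le` |
| BKLOS §9.1 display (9.2), p0014 L35–L37 = BES (7.4), p0015 L135–L138 | `….casselsFormula_selmerRatio` | FAITHFUL (`3`-isogenies, as printed there; `TODO(general form)`: any isogeny, Cassels 1965 VIII) |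
| BKLOS §9.2, p0014 L43 with BES Prop. 42 (ii), p0017 L14 | `….selmerRank_parity_of_isInSelmerRatioClass` | FAITHFUL to BES (torsion term `dim E_s(F)[3]` kept); LOCATED: the BKLOS paraphrase "`s ∈ T_m(φ) ⇒ dim Sel₃(E_s) ≡ m (mod 2)`" drops that term and is off by one at the finitely many classes with `E_s(F)[3] ≅ ℤ/3` (harmless to Thms. 2.4–2.6) |

Proved (0 facts): `kerAction` API, `mem_selmerGroup_iff`, `ratKerCard_pos`/`_le_degree`,
`quadraticTwist_comp_quadraticTwist` (`ψ ∘ φ = [n] ⟹ ψ_s ∘ φ_s = [n]`); from Cassels' formula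
"`c(φ)c(φ̂) = 1`" (p0014 L39), `t(φ̂) = −t(φ)`, `T_m(φ) = T_m(φ̂)`; from the parity fact its
torsion-free reading, "every twist within `T_0(φ)` has even `3`-Selmer rank" (p0014 L43) and the
"off finitely many classes" form (Mazur–Rubin 2010 L.5.5 = `finite_setOf_twistClass_natCard_torsionBy_ne_one`).
Not done: `Finite (Sel_φ)` (AEC X.4.2 (b); carried as clauses of Cassels' formula); BKLOS Lemma 9.1 /
BES Prop. 42 (i) (needs the bridge `Isogeny.selmerGroup [n] ≃ W.selmerGroup n`); the Kummer-image
form of the local conditions; Thms. 2.2/2.3 (abelian varieties).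

## References

* [BhargavaKlagsbrunLemkeOliverShnidman2019] Duke Math. J. 168 (2019) 2951–2989 = arXiv:1709.09790,
  §2 Thm. 2.1 (chunk p0004), §7 (p0011), §8 Thm. 8.1 (p0012), §9.1–9.2 (p0014).
* [BhargavaElkiesShnidman2019] M. Bhargava, N. Elkies, A. Shnidman, J. Lond. Math. Soc. (2) 101
  (2020) 299–327 = arXiv:1610.05759, Prop. 42 (chunk p0017 L9–L23), (7.4) (p0015 L135–L138).
* [Cassels1965ArithmeticVIII] J. W. S. Cassels, J. reine angew. Math. 217 (1965) 180–199.
* [SilvermanAEC2009] J. H. Silverman, *The Arithmetic of Elliptic Curves*, 2nd ed., X.§4 (Selmer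
  group of an isogeny, Thm. X.4.2), III.§4, III.§6 (dual isogeny).
-/

noncomputable section

open scoped Classical NumberField
open Filter Topology
open WeierstrassCurve IsDedekindDomain NumberField

universe u

/-! ## §1 The carrier: `E[φ]` as a `Γ_K`-module, `H¹(K, E[φ])`, local kernels, `Sel_φ(E/K)` -/

namespace WeierstrassCurve.Isogeny

open Literature.NumberTheory.EllipticCurves

variable {K : Type u} [Field K] {W W' : WeierstrassCurve K}

/-- `E[φ] = ker φ ⊆ E(K̄)` is stable under `Γ_K = Gal(K̄/K)`: `φ(σP) = σ φ(P) = σ O = O` (the isogeny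
is defined over `K`). Silverman, *AEC*, III.§4 (remark after 4.10: `E[φ]` is a `G_{K̄/K}`-module)
and X.§4. [cite: SilvermanAEC2009, X.§4 (Thm. X.4.2, the G-module E[φ])] -/
theorem smul_mem_ker (φ : Isogeny W W') (σ : Field.absoluteGaloisGroup K) {P : W.geomPoints}
    (hP : P ∈ φ.toAddMonoidHom.ker) : σ • P ∈ φ.toAddMonoidHom.ker := by
  rw [AddMonoidHom.mem_ker, coe_toAddMonoidHom] at hP ⊢
  rw [map_smul, hP, smul_zero]

/-- **The `Γ_K`-module `E[φ]`**: the distributive action of `Γ_K` on `E(K̄)` restricted to the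
kernel of the isogeny `φ` (`(σ • P : E[φ]) = σ • (P : E(K̄))`). A `def`, not an instance (it is
supplied to the cohomology glue by `letI`; an `abbrev`, as Lean requires definitions of class type to be
reducible). Silverman, *AEC*, X.§4 (the `G_{K̄/K}`-module `E[φ]`
in Thm. X.4.2); BKLOS §7 (chunk p0011 L3, "`H¹(G_F, A[φ])`").
[cite: SilvermanAEC2009, X.§4 (Thm. X.4.2)] -/
abbrev kerAction (φ : Isogeny W W') :
    DistribMulAction (Field.absoluteGaloisGroup K) φ.toAddMonoidHom.ker where
  smul σ P := ⟨σ • (P : W.geomPoints), φ.smul_mem_ker σ P.2⟩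
  one_smul P := Subtype.ext (one_smul (Field.absoluteGaloisGroup K) (P : W.geomPoints))
  mul_smul σ τ P := Subtype.ext (mul_smul σ τ (P : W.geomPoints))
  smul_zero σ := Subtype.ext (smul_zero σ)
  smul_add σ P Q := Subtype.ext (smul_add σ (P : W.geomPoints) Q)

/-- Unfolding the action on `E[φ]`: `((σ • P : E[φ]) : E(K̄)) = σ • (P : E(K̄))`.
[cite: SilvermanAEC2009, X.§4 (Thm. X.4.2)] -/
theorem kerAction_coe_smul (φ : Isogeny W W') (σ : Field.absoluteGaloisGroup K)
    (P : φ.toAddMonoidHom.ker) :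
    letI := φ.kerAction
    ((σ • P : φ.toAddMonoidHom.ker) : W.geomPoints) = σ • (P : W.geomPoints) :=
  rfl

/-- **`H¹(K, E[φ]) = H¹_cont(Γ_K, E[φ])`**, the Galois cohomology of the finite discrete
`Γ_K`-module `E[φ]` (the tree's `discreteH1`, i.e. Mathlib's `continuousCohomology 1`, for the action
`Isogeny.kerAction`). Silverman, *AEC*, X.§4; BKLOS §7 (chunk p0011 L3).
[cite: BhargavaKlagsbrunLemkeOliverShnidman2019, §7 (chunk p0011 L3, "the subgroup of H¹(G_F, A[φ])")] -/
abbrev galH1Ker (φ : Isogeny W W') : Type u :=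
  letI := φ.kerAction
  discreteH1 (Field.absoluteGaloisGroup K) φ.toAddMonoidHom.ker

variable (E : Type u) [Field E] [Algebra K E]

/-- **The local condition at a `K`-field `E`** (a completion `K_v`): the kernel of
`H¹(K, E[φ]) → H¹(E, E(K̄_E))` induced by the compatible pair
`(resGal E : Γ_E → Γ_K, pointsMap ∘ (E[φ] ↪ E(K̄)) : E[φ] → E(K̄_E))` for the chosen embedding
`closureEmb E : K̄ → K̄_E` — BKLOS §7: "the classes locally in the kernel of the map
`H¹(G_{F_v}, A[φ]) → H¹(G_{F_v}, A)`". Built with the tree's `resKer`, exactly as `selmerLocalKer`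
(`Selmer.lean`) for `E[n]`.
[cite: BhargavaKlagsbrunLemkeOliverShnidman2019, §7 (chunk p0011 L7–L9)] -/
def selmerLocalKer (φ : Isogeny W W') : AddSubgroup φ.galH1Ker :=
  letI := φ.kerAction
  resKer (resGal (K := K) E) ((pointsMap W E).comp φ.toAddMonoidHom.ker.subtype) fun σ P ↦
    pointsMap_smul W E σ (P : W.geomPoints)

variable {E}

section NumberField

variable [NumberField K]

/-- **The `φ`-Selmer group `Sel_φ(E/K) ⊆ H¹(K, E[φ])`** of an isogeny `φ : E → E'` over a number
field `K`: the classes whose image in `H¹(K_v, E)` vanishes for every finite place `v`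
(`K_v = v.adicCompletion K`) and every infinite place `w` (`K_w = w.Completion`). BKLOS §7 (chunk
p0011 L3–L9); Silverman, *AEC*, X.§4 (the `φ`-Selmer group `S^{(φ)}(E/K)`, Thm. X.4.2: equal to the
Kummer-condition group by exactness of `0 → E'(K_v)/φE(K_v) → H¹(K_v, E[φ]) → H¹(K_v, E)[φ] → 0`).
For `φ = [n]` this is the tree's `WeierstrassCurve.selmerGroup n` up to the identification
`ker [n] = E[n]` of coefficient modules (not made here).
[cite: BhargavaKlagsbrunLemkeOliverShnidman2019, §7 (chunk p0011 L3–L9)]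
[cite: SilvermanAEC2009, X.§4 (Thm. X.4.2)] -/
def selmerGroup (φ : Isogeny W W') : AddSubgroup φ.galH1Ker :=
  (⨅ v : HeightOneSpectrum (𝓞 K), φ.selmerLocalKer (v.adicCompletion K)) ⊓
    ⨅ w : InfinitePlace K, φ.selmerLocalKer w.Completion

/-- Membership in `Sel_φ(E/K)`: a class lies in the `φ`-Selmer group iff it dies in `H¹(K_v, E)`
for all finite `v` and all infinite `w`. [cite: BhargavaKlagsbrunLemkeOliverShnidman2019, §7 (chunk p0011 L7–L9)] -/
theorem mem_selmerGroup_iff (φ : Isogeny W W') (c : φ.galH1Ker) :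
    c ∈ φ.selmerGroup ↔
      (∀ v : HeightOneSpectrum (𝓞 K), c ∈ φ.selmerLocalKer (v.adicCompletion K)) ∧
        ∀ w : InfinitePlace K, c ∈ φ.selmerLocalKer w.Completion := by
  simp only [selmerGroup, AddSubgroup.mem_inf, AddSubgroup.mem_iInf]

end NumberField

/-- **`#E[φ](K)`**, the number of `K`-rational points of the kernel of `φ` (the groups "`E[φ](F)`",
"`E'[φ̂](F)`" of Cassels' formula, BKLOS §9.1 display): the `Γ_K`-fixed points of `E[φ] ⊆ E(K̄)`
(`K`-rational points = `Γ_K`-fixed points, Silverman *AEC* I.§1 / VIII.§1, the tree's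
`fixedPoints_eq_range_map_holds`). [cite: BhargavaKlagsbrunLemkeOliverShnidman2019, §9.1 (chunk p0014 L35–L37)] -/
def ratKerCard (φ : Isogeny W W') : ℕ :=
  Nat.card {P : W.geomPoints // φ P = 0 ∧ ∀ σ : Field.absoluteGaloisGroup K, σ • P = P}

/-- `#E[φ](K) ≥ 1` (`O` is a rational point of the kernel; the kernel is finite).
[cite: SilvermanAEC2009, III.§4 (Cor. 4.9: ker φ finite)] -/
theorem ratKerCard_pos (φ : Isogeny W W') : 0 < φ.ratKerCard := by
  unfold ratKerCard
  haveI : Finite {P : W.geomPoints // φ P = 0 ∧ ∀ σ : Field.absoluteGaloisGroup K, σ • P = P} :=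
    Finite.of_injective (fun P ↦ (⟨P.1, by
      rw [AddMonoidHom.mem_ker, coe_toAddMonoidHom]; exact P.2.1⟩ : φ.toAddMonoidHom.ker))
      (fun P Q h ↦ Subtype.ext (by simpa using Subtype.ext_iff.mp h))
  haveI : Nonempty {P : W.geomPoints // φ P = 0 ∧ ∀ σ : Field.absoluteGaloisGroup K, σ • P = P} :=
    ⟨⟨0, map_zero φ, fun σ ↦ smul_zero σ⟩⟩
  exact Nat.card_pos

/-- `#E[φ](K) ≤ #E[φ] = deg φ` (separable degree; the degree in characteristic `0`).
[cite: SilvermanAEC2009, III.§4 (Thm. 4.10 (c))] -/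
theorem ratKerCard_le_degree (φ : Isogeny W W') : φ.ratKerCard ≤ φ.degree := by
  unfold ratKerCard degree
  exact Nat.card_le_card_of_injective (fun P ↦ (⟨P.1, by
      rw [AddMonoidHom.mem_ker, coe_toAddMonoidHom]; exact P.2.1⟩ : φ.toAddMonoidHom.ker))
    (fun P Q h ↦ Subtype.ext (by simpa using Subtype.ext_iff.mp h))

/-! ### Twisting a dual pair -/

section Twist

variable [NeZero (2 : K)] {V V' : WeierstrassCurve K} [V.IsCharNeTwoNF] [V'.IsCharNeTwoNF]

/-- **Twisting preserves duality**: if `ψ ∘ φ = [n]` on `E(K̄)` then `ψ_s ∘ φ_s = [n]` on `E_s(K̄)`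
(the twists are `ι'⁻¹ ∘ φ ∘ ι` and `ι⁻¹ ∘ ψ ∘ ι'` for the untwisting isomorphisms `ι`, `ι'`, the tree's
`Isogeny.quadraticTwist_apply`). So the dual of the twisted `3`-isogeny `φ_s` is `(φ̂)_s`, as used
throughout BKLOS §9 ("`Sel_{φ̂}(E'_s)`", p0014 L39). [cite: BhargavaKlagsbrunLemkeOliverShnidman2019, §9.1 (chunk p0014 L39)] -/
theorem quadraticTwist_comp_quadraticTwist (φ : Isogeny V V') (ψ : Isogeny V' V) {n : ℤ}
    (h : ∀ P, ψ (φ P) = n • P) {s : K} (hs : s ≠ 0) (P : (V.quadraticTwist s).geomPoints) :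
    ψ.quadraticTwist hs (φ.quadraticTwist hs P) = n • P := by
  rw [quadraticTwist_apply, quadraticTwist_apply, AddEquiv.apply_symm_apply, h, map_zsmul,
    AddEquiv.symm_apply_apply]

end Twist

end WeierstrassCurve.Isogeny

/-! ## §2 The twist-family functions `#Sel_{φ_s}(E_s)` and `c(φ_s)` on `F^*/F^{*2}` -/

namespace Literature.NumberTheory.EllipticCurves

namespace BhargavaKlagsbrunLemkeOliverShnidman2019

variable {K : Type u} [Field K] [NumberField K] {V V' : WeierstrassCurve K}
  [V.IsCharNeTwoNF] [V'.IsCharNeTwoNF]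

/-- **`|Sel_{φ_s}(E_s)|` as a function of `s ∈ F^*/F^{*2}`** (source, Thm. 2.1: "the average size
of `Sel_{φ_s}(A_s)`"), evaluated at the representative `Quotient.out t` of the class `t` (the twisted
pair `φ_s : E_s → E'_s` of a class is a `K`-isomorphism class, p0003 L3 / p0004 L3; same convention as
`rankBoundSummand`); `Nat.card`, real-valued for averaging.
[cite: BhargavaKlagsbrunLemkeOliverShnidman2019, Thm. 2.1 (chunk p0004 L32–L36)] -/
def twistSelmerCard (φ : Isogeny V V') (t : SquareClass K) : ℝ :=
  Nat.card ((φ.quadraticTwist (Units.ne_zero (Quotient.out t : Kˣ))).selmerGroup)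

/-- **The Selmer ratio `c(φ_s)` as a function of `s ∈ F^*/F^{*2}`** (source, §2: "`avg_Σ c(φ_s)`"),
at the representative `Quotient.out t`; real-valued for averaging.
[cite: BhargavaKlagsbrunLemkeOliverShnidman2019, §2 (chunk p0004 L26–L30, avg_Σ c(φ_s))] -/
def twistSelmerRatio (φ : Isogeny V V') (t : SquareClass K) : ℝ :=
  (selmerRatio (φ.quadraticTwist (Units.ne_zero (Quotient.out t : Kˣ))) : ℚ)

/-! ## §3 The printed statements (named facts, REFEREED) -/

/-- **Bhargava–Klagsbrun–Lemke Oliver–Shnidman 2019, Theorem 2.1** (Duke Math. J. 168; "Our main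
result is"): "Let `φ : A → A'` be a `3`-isogeny of abelian varieties over a number field `F`, and let
`Σ` be a non-empty subset of `F^*/F^{*2}` defined by finitely many local conditions. When the abelian
varieties `A_s`, `s ∈ Σ`, are ordered by the height of `s`, the average size of `Sel_{φ_s}(A_s)` is
`1 + avg_Σ c(φ_s)`." Transcription, for ELLIPTIC CURVES (the case of §9 and Thms. 2.4–2.7;
`TODO(general form)`: abelian varieties — no twist vocabulary for them in the tree): `F = K`;
`φ : Isogeny V V'` of degree `3` between elliptic models with `a₁ = a₃ = 0` (twisting convention
`s̃y² = f(x)`, p0003 L3; the tree's `Isogeny.quadraticTwist`); `Σ = S` non-empty with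
`IsDefinedByFinitelyManyLocalConditions S`; "`avg_Σ c(φ_s) := lim_X (1/|Σ(X)|) ∑_{s ∈ Σ(X)} c(φ_s)`"
(p0004 L26–L30, a finite Euler product by Thm. 8.1) enters as the hypothesis that the finite averages
of `twistSelmerRatio φ` tend to `a` — the binder does not itself assert that this limit exists (as in
`thm24_averageRank_le`); conclusion: the finite averages of `twistSelmerCard φ` over `Σ(X)` tend to
`1 + a` (Thm. 8.1, p0012 L41–L48). REFEREED; no `_holds` expected (count of locally soluble binary
cubic forms over a global field, §§5–8).
[cite: BhargavaKlagsbrunLemkeOliverShnidman2019, Thm. 2.1 (chunk p0004 L32–L36) with §2 (chunk p0004 L20–L30) and Thm. 8.1 (chunk p0012 L41–L48)] -/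
def thm21_averageCard_selmerGroup : Prop :=
  ∀ (K : Type) [Field K] [NumberField K] (V V' : WeierstrassCurve K) [V.IsElliptic] [V'.IsElliptic]
    [V.IsCharNeTwoNF] [V'.IsCharNeTwoNF] (φ : Isogeny V V'), φ.degree = 3 →
    ∀ (S : Set (SquareClass K)), S.Nonempty → IsDefinedByFinitelyManyLocalConditions S →
    ∀ (a : ℝ), Tendsto (squareClassAverage S (twistSelmerRatio φ)) atTop (𝓝 a) →
      Tendsto (squareClassAverage S (twistSelmerCard φ)) atTop (𝓝 (1 + a))

/-- **Cassels' formula** for the Selmer ratio of a `3`-isogeny `φ : E → E'` with dual `φ̂` over a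
number field, as printed in BKLOS §9.1, display (9.2): "`c(φ) = |Sel_φ(E)| |E'[φ̂](F)| /
(|Sel_{φ̂}(E')| |E[φ](F)|)`" ("Cassels' formula [Cassels8]" = Cassels, J. reine angew. Math. 217
(1965), VIII; the same display is Bhargava–Elkies–Shnidman (7.4) for `E_k → E_{−27k}` over `ℚ`; BKLOS
print "`(ℚ)`" for the rational kernels inside a section over `F` — read `(F)`). Transcription:
`F = K`; `φ : Isogeny V V'` of degree `3` between elliptic curves and `ψ : Isogeny V' V` its dual,
`ψ ∘ φ = [3]` on `E(K̄)` (Silverman *AEC* III.6.1; unique); `c(φ)` = `selmerRatio φ`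
(`∏_{𝔭 ≤ ∞} c_𝔭(φ)`); `|E[φ](F)|`, `|E'[φ̂](F)|` = `ratKerCard`; the two Selmer groups are FINITE
(Silverman *AEC* X.4.2 (b); recorded as the first two clauses, so that the `Nat.card`s are the
orders) and `c(φ) · |Sel_{φ̂}(E')| · |E[φ](F)| = |Sel_φ(E)| · |E'[φ̂](F)|`. `TODO(general form)`:
every isogeny of elliptic curves over a number field (Cassels). REFEREED; no `_holds` expected.
[cite: BhargavaKlagsbrunLemkeOliverShnidman2019, §9.1 (chunk p0014 L35–L37, display (9.2) "Cassels' formula")]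
[cite: Cassels1965ArithmeticVIII, as quoted by BKLOS §9.1 (9.2) and BES (7.4) (original not held: acq-00278, cite-only)]
[cite: BhargavaElkiesShnidman2019, §7.4 (chunk p0015 L135–L138, display (7.4))] -/
def casselsFormula_selmerRatio : Prop :=
  ∀ (K : Type) [Field K] [NumberField K] (V V' : WeierstrassCurve K) [V.IsElliptic] [V'.IsElliptic]
    (φ : Isogeny V V') (ψ : Isogeny V' V), φ.degree = 3 → (∀ P, ψ (φ P) = (3 : ℤ) • P) →
    Finite φ.selmerGroup ∧ Finite ψ.selmerGroup ∧
      (selmerRatio φ : ℚ) * Nat.card ψ.selmerGroup * φ.ratKerCard =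
        Nat.card φ.selmerGroup * ψ.ratKerCard

/-- **Parity of the `3`-Selmer rank on `T_m(φ)`** — BKLOS §9.2: "The only additional input needed
is a result of Cassels [Cassels8] which shows that if `s ∈ T_m(φ)`, then
`dim_{𝔽₃} Sel₃(E_s) ≡ m (mod 2)`; see [j=0]", in the precise form printed in [j=0] =
Bhargava–Elkies–Shnidman, Prop. 42 (ii): "If `c(φ) = 3^m`, then `m ≡ r₃(E) − dim_{𝔽₃} E[3](ℚ)
(mod 2)`" (`r₃(E) = dim_{𝔽₃} Sel₃(E)`; proof there: the five-term sequence (8.1)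
`0 → E'(ℚ)[φ̂]/φ(E(ℚ)[3]) → Sel_φ(E) → Sel₃(E) → Sel_{φ̂}(E') → Ш(E')[φ̂]/φ(Ш(E)[3]) → 0`, whose last
term is even-dimensional by the Cassels–Tate pairing, together with Cassels' formula).
Transcription: `F = K` a number field; `φ : Isogeny V V'` of degree `3` between elliptic models
with `a₁ = a₃ = 0`; `s ∈ F^*` with its class in `T_m(φ)` (`IsInSelmerRatioClass φ m`, i.e.
`|t(φ_s)| = m`; the parity of `t = ±m` is that of `m`); conclusion `#Sel^{(3)}(E_s/F) = 3^r`,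
`#E_s(F)[3] = 3^e` with `m ≡ r + e (mod 2)` (`≡ r − e`; the tree's `WeierstrassCurve.selmerGroup 3 ⊆
H¹(K, E[3])` and `E_s(F)[3] = AddSubgroup.torsionBy E_s(F) 3`, both `𝔽₃`-spaces; `Nat.card`
currency of `thm25_proportions` and of `finite_setOf_twistClass_natCard_torsionBy_ne_one`).
LOCATED: the BKLOS sentence omits the term `dim E_s(F)[3]` and is therefore off by one exactly at
the classes with `E_s(F)[3] ≅ ℤ/3` (e.g. `y² = x³ + 1`, `s = 1`: `r₃ = 1`, `t = −2`) — finitely many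
classes (Mazur–Rubin 2010 L.5.5), so harmless to their density theorems; this binder is BKLOS's
claim with BES's torsion term restored (BES print it for the curves `y² = x³ + k` over `ℚ`; BKLOS
invoke it for every `3`-isogeny over `F`, "see [j=0]", the argument being the same). REFEREED; no
`_holds` expected (Cassels–Tate pairing).
[cite: BhargavaKlagsbrunLemkeOliverShnidman2019, §9.2 (chunk p0014 L43)]
[cite: BhargavaElkiesShnidman2019, Prop. 42 (ii) (chunk p0017 L9–L23)]
[cite: Cassels1965ArithmeticVIII, as quoted by BKLOS §9.2 and BES Prop. 42 (original not held: acq-00278, cite-only)] -/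
def selmerRank_parity_of_isInSelmerRatioClass : Prop :=
  ∀ (K : Type) [Field K] [NumberField K] (V V' : WeierstrassCurve K) [V.IsElliptic] [V'.IsElliptic]
    [V.IsCharNeTwoNF] [V'.IsCharNeTwoNF] (φ : Isogeny V V'), φ.degree = 3 →
    ∀ (m : ℕ) (s : Kˣ), IsInSelmerRatioClass φ m (QuotientGroup.mk s) →
      ∃ r e : ℕ, Nat.card ((V.quadraticTwist (s : K)).selmerGroup 3) = 3 ^ r ∧
        Nat.card (AddSubgroup.torsionBy (V.quadraticTwist (s : K)).toAffine.Point (3 : ℤ)) = 3 ^ e ∧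
          (Even m ↔ Even (r + e))

/-! ## §4 Proved read-outs -/

/-- **"`c(φ)c(φ̂) = 1`"** (BKLOS §9.1, p0014 L39: "Cassels' formula … shows that `c(φ)c(φ̂) = 1`"),
from `casselsFormula_selmerRatio` applied to the dual pair in both orders (`ψ ∘ φ = [3]` and
`φ ∘ ψ = [3]`, Silverman *AEC* III.6.2). [cite: BhargavaKlagsbrunLemkeOliverShnidman2019, §9.1 (chunk p0014 L39)] -/
theorem selmerRatio_mul_selmerRatio_eq_one (h : casselsFormula_selmerRatio) {K : Type} [Field K]
    [NumberField K] {V V' : WeierstrassCurve K} [V.IsElliptic] [V'.IsElliptic] (φ : Isogeny V V')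
    (ψ : Isogeny V' V) (hφ : φ.degree = 3) (hψ : ψ.degree = 3)
    (hψφ : ∀ P, ψ (φ P) = (3 : ℤ) • P) (hφψ : ∀ Q, φ (ψ Q) = (3 : ℤ) • Q) :
    selmerRatio φ * selmerRatio ψ = 1 := by
  obtain ⟨hf₁, hf₂, h₁⟩ := h K V V' φ ψ hφ hψφ
  obtain ⟨-, -, h₂⟩ := h K V' V ψ φ hψ hφψ
  have ha : (0 : ℚ) < Nat.card φ.selmerGroup := by
    haveI := hf₁; exact_mod_cast (Nat.card_pos : 0 < Nat.card φ.selmerGroup)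
  have hb : (0 : ℚ) < Nat.card ψ.selmerGroup := by
    haveI := hf₂; exact_mod_cast (Nat.card_pos : 0 < Nat.card ψ.selmerGroup)
  have hc : (0 : ℚ) < φ.ratKerCard := by exact_mod_cast φ.ratKerCard_pos
  have hd : (0 : ℚ) < ψ.ratKerCard := by exact_mod_cast ψ.ratKerCard_pos
  -- `c(φ) · b · c = a · d` and `c(ψ) · a · d = b · c`, all of `a b c d` positive.
  have hbc : (Nat.card ψ.selmerGroup : ℚ) * φ.ratKerCard ≠ 0 := by positivity
  have had : (Nat.card φ.selmerGroup : ℚ) * ψ.ratKerCard ≠ 0 := by positivity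
  have e₁ : selmerRatio φ =
      (Nat.card φ.selmerGroup * ψ.ratKerCard : ℚ) / (Nat.card ψ.selmerGroup * φ.ratKerCard) := by
    rw [eq_div_iff hbc, ← h₁, mul_assoc]
  have e₂ : selmerRatio ψ =
      (Nat.card ψ.selmerGroup * φ.ratKerCard : ℚ) / (Nat.card φ.selmerGroup * ψ.ratKerCard) := by
    rw [eq_div_iff had, ← h₂, mul_assoc]
  rw [e₁, e₂, div_mul_div_comm, mul_comm ((Nat.card ψ.selmerGroup : ℚ) * φ.ratKerCard)]
  exact div_self (mul_ne_zero had hbc)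

/-- **`t(φ̂) = −t(φ)`** (from `c(φ)c(φ̂) = 1`): the logarithmic Selmer ratios of a dual pair of
`3`-isogenies are opposite, so `T_m(φ)` (defined by `|t| = m`) is symmetric in `φ ↔ φ̂` — BKLOS §9.1
use `T_m` for both `Sel_φ(E_s)` and `Sel_{φ̂}(E'_s)`. [cite: BhargavaKlagsbrunLemkeOliverShnidman2019, §9.1 (chunk p0014 L37–L39)] -/
theorem logSelmerRatio_dual_eq_neg (h : casselsFormula_selmerRatio) {K : Type} [Field K]
    [NumberField K] {V V' : WeierstrassCurve K} [V.IsElliptic] [V'.IsElliptic] (φ : Isogeny V V')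
    (ψ : Isogeny V' V) (hφ : φ.degree = 3) (hψ : ψ.degree = 3)
    (hψφ : ∀ P, ψ (φ P) = (3 : ℤ) • P) (hφψ : ∀ Q, φ (ψ Q) = (3 : ℤ) • Q) :
    logSelmerRatio ψ = -logSelmerRatio φ := by
  have h1 := selmerRatio_mul_selmerRatio_eq_one h φ ψ hφ hψ hψφ hφψ
  have hφ0 : selmerRatio φ ≠ 0 := left_ne_zero_of_mul_eq_one h1
  have hψ0 : selmerRatio ψ ≠ 0 := right_ne_zero_of_mul_eq_one h1
  unfold logSelmerRatio
  have := padicValRat.mul (p := 3) hφ0 hψ0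
  rw [h1, padicValRat.one] at this
  linarith

/-- **`T_m(φ) = T_m(φ̂)`**: granted Cassels' formula, a square class lies in `T_m(φ)` iff it lies in
`T_m(φ̂)` — the dual of the twisted isogeny `φ_s` is `(φ̂)_s` (`quadraticTwist_comp_quadraticTwist`),
twisting preserves the degree (`degree_quadraticTwist`), and `t((φ̂)_s) = −t(φ_s)`. This is why BKLOS
§9.1 can speak of "the average size of `Sel_{φ̂}(E'_s)` for `s ∈ T_m`" with the SAME `T_m`.
[cite: BhargavaKlagsbrunLemkeOliverShnidman2019, §9.1 (chunk p0014 L37–L39)] -/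
theorem isInSelmerRatioClass_dual_iff (h : casselsFormula_selmerRatio) {K : Type} [Field K]
    [NumberField K] {V V' : WeierstrassCurve K} [V.IsElliptic] [V'.IsElliptic] [V.IsCharNeTwoNF]
    [V'.IsCharNeTwoNF] (φ : Isogeny V V') (ψ : Isogeny V' V) (hφ : φ.degree = 3)
    (hψ : ψ.degree = 3) (hψφ : ∀ P, ψ (φ P) = (3 : ℤ) • P) (hφψ : ∀ Q, φ (ψ Q) = (3 : ℤ) • Q)
    (m : ℕ) (t : SquareClass K) :
    IsInSelmerRatioClass φ m t ↔ IsInSelmerRatioClass ψ m t := by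
  have key : ∀ s : Kˣ, (logSelmerRatio (ψ.quadraticTwist (Units.ne_zero s))).natAbs =
      (logSelmerRatio (φ.quadraticTwist (Units.ne_zero s))).natAbs := by
    intro s
    haveI := V.isElliptic_quadraticTwist (Units.ne_zero s)
    haveI := V'.isElliptic_quadraticTwist (Units.ne_zero s)
    rw [logSelmerRatio_dual_eq_neg h (φ.quadraticTwist (Units.ne_zero s))
      (ψ.quadraticTwist (Units.ne_zero s)) (by rw [Isogeny.degree_quadraticTwist, hφ])
      (by rw [Isogeny.degree_quadraticTwist, hψ])
      (Isogeny.quadraticTwist_comp_quadraticTwist φ ψ hψφ (Units.ne_zero s))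
      (Isogeny.quadraticTwist_comp_quadraticTwist ψ φ hφψ (Units.ne_zero s)), Int.natAbs_neg]
  simp only [IsInSelmerRatioClass, key]

/-- **The torsion-free reading** (BKLOS's sentence where it is exact): for `s ∈ T_m(φ)` with
`E_s(F)[3] = 0`, `#Sel^{(3)}(E_s/F) = 3^r` with `r ≡ m (mod 2)`.
[cite: BhargavaKlagsbrunLemkeOliverShnidman2019, §9.2 (chunk p0014 L43)] -/
theorem selmerRank_parity_of_torsion_trivial (h : selmerRank_parity_of_isInSelmerRatioClass)
    {K : Type} [Field K] [NumberField K] {V V' : WeierstrassCurve K} [V.IsElliptic] [V'.IsElliptic]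
    [V.IsCharNeTwoNF] [V'.IsCharNeTwoNF] (φ : Isogeny V V') (hφ : φ.degree = 3) (m : ℕ) (s : Kˣ)
    (hT : IsInSelmerRatioClass φ m (QuotientGroup.mk s))
    (htors : Nat.card (AddSubgroup.torsionBy (V.quadraticTwist (s : K)).toAffine.Point (3 : ℤ)) = 1) :
    ∃ r : ℕ, Nat.card ((V.quadraticTwist (s : K)).selmerGroup 3) = 3 ^ r ∧ (Even r ↔ Even m) := by
  obtain ⟨r, e, hr, he, hpar⟩ := h K V V' φ hφ m s hT
  rw [htors] at he
  have he0 : e = 0 := by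
    by_contra hne
    have : (1 : ℕ) < 3 ^ e := Nat.one_lt_pow hne (by norm_num)
    omega
  subst he0
  exact ⟨r, hr, by rw [hpar, add_zero]⟩

/-- **"Every twist within `T_0(φ)` has even `3`-Selmer rank"** (BKLOS §9.2, p0014 L43), for the
twists with `E_s(F)[3] = 0`: `#Sel^{(3)}(E_s/F)` is an even power of `3`.
[cite: BhargavaKlagsbrunLemkeOliverShnidman2019, §9.2 (chunk p0014 L43)] -/
theorem even_selmerRank_of_isInSelmerRatioClass_zero (h : selmerRank_parity_of_isInSelmerRatioClass)
    {K : Type} [Field K] [NumberField K] {V V' : WeierstrassCurve K} [V.IsElliptic] [V'.IsElliptic]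
    [V.IsCharNeTwoNF] [V'.IsCharNeTwoNF] (φ : Isogeny V V') (hφ : φ.degree = 3) (s : Kˣ)
    (hT : IsInSelmerRatioClass φ 0 (QuotientGroup.mk s))
    (htors : Nat.card (AddSubgroup.torsionBy (V.quadraticTwist (s : K)).toAffine.Point (3 : ℤ)) = 1) :
    ∃ j : ℕ, Nat.card ((V.quadraticTwist (s : K)).selmerGroup 3) = 9 ^ j := by
  obtain ⟨r, hr, hpar⟩ := selmerRank_parity_of_torsion_trivial h φ hφ 0 s hT htors
  obtain ⟨j, rfl⟩ := hpar.2 (by decide)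
  exact ⟨j, by rw [hr, ← two_mul, pow_mul]; norm_num⟩

/-- **Parity on `T_0(φ)` off a finite set of classes**: granted the parity fact, all but finitely
many square classes `t` have the property "if `t ∈ T_0(φ)` then every twist `E_s`, `[s] = t`, has
`#Sel^{(3)}(E_s/F)` an even power of `3`" — the exceptional classes being those carrying a non-trivial
`F`-rational `3`-torsion point, finitely many by Mazur–Rubin, Invent. Math. 181 (2010) Lemma 5.5
(the tree's `finite_setOf_twistClass_natCard_torsionBy_ne_one`, `p = 3` odd). This is the form in
which BKLOS's sentence (p0014 L43) enters their density arguments.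
[cite: BhargavaKlagsbrunLemkeOliverShnidman2019, §9.2 (chunk p0014 L43)] -/
theorem eventually_even_selmerRank_on_T0 (h : selmerRank_parity_of_isInSelmerRatioClass)
    {K : Type} [Field K] [NumberField K] {V V' : WeierstrassCurve K} [V.IsElliptic] [V'.IsElliptic]
    [V.IsCharNeTwoNF] [V'.IsCharNeTwoNF] (φ : Isogeny V V') (hφ : φ.degree = 3) :
    {t : SquareClass K | ¬ (IsInSelmerRatioClass φ 0 t →
      ∀ s : Kˣ, (QuotientGroup.mk s : SquareClass K) = t →
        ∃ j : ℕ, Nat.card ((V.quadraticTwist (s : K)).selmerGroup 3) = 9 ^ j)}.Finite := by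
  refine (finite_setOf_twistClass_natCard_torsionBy_ne_one V (p := 3) (by decide)).subset ?_
  intro t ht
  simp only [Set.mem_setOf_eq, Classical.not_imp, not_forall, not_exists] at ht
  obtain ⟨hT, s, hst, hs⟩ := ht
  refine ⟨s, hst, fun htors ↦ ?_⟩
  obtain ⟨j, hj⟩ := even_selmerRank_of_isInSelmerRatioClass_zero h φ hφ s (hst ▸ hT) htors
  exact hs j hj

end BhargavaKlagsbrunLemkeOliverShnidman2019

end Literature.NumberTheory.EllipticCurves
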